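import Summits.Ventures.HodgeRepro2.T7SupportTwoVectorArchimedean

/-!
# The model with a CHARACTER at the compact place, for the two-vector `f` (support, seat p1)

`T7SupportTwoVectorArchimedean.exists_mem_dense_regular_twoVectorOrbital_ne_zero₃_model` asks for regularity
(`κ_{ι₁}(γ₀) ≠ 1`) at the compact place too. The line's actual `ι₁` component is a CHARACTER (L3-ARGUMENT §4a (b); memo
v16 R5: for the two-vector `f` the `ι₁` factor is the character version, `u_A = u_B = 1_τ` up to a scalar), where the
two-vector orbital integral is `χ(γ h) ‖x‖²` and never vanishes — no regularity and no condition is needed there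
(t7-crit-1 g3 l. 15420, record R10). This file is the minimal form (the twin of row 714 for the two-vector `f`):

* `continuous_twoVectorOrbital_of_character` — on a `τ`-stable line with continuous character `χ` the two-vector
  orbital integral `γ ↦ χ(γ h) ⟪x, x⟫` is continuous (no strong continuity of `τ` needed);
* `exists_mem_dense_regular_twoVectorOrbital_ne_zero₃_character` — `ι₁` ANY topological group `G₁` with a unitary `τ`
  on a `τ`-stable line (continuous character), `ι₂, ι₃` the weight-`k_j` Bergman models of `SU(1,1)` with `u_A = z^{n_j}`
  (row 680's `torusOrbital`): every dense `S ⊆ G₁ × SU(1,1) × SU(1,1)` contains a `γ₀` regular at `ι₂, ι₃` with the product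
  of the three two-vector orbital integrals non-zero — nothing required at `ι₁` (`Z₁ = ∅`);
* `exists_mem_dense_regular_coeff_ne_zero₃_character` — the same as
  `χ(γ₀,1 h₁) ⟪x, x⟫ · ⟨π_{k₂}(γ₀,2 h₂) z^{n₂}, z^{n₂}⟩ · ⟨π_{k₃}(γ₀,3 h₃) z^{n₃}, z^{n₃}⟩ ≠ 0`.

Explicit model and abstract representations only; nothing about the adelic group, any period, or (N).
Blind lane: Mathlib + the HodgeRepro2 prefix only; no sorry; axioms ⊆ {propext, Classical.choice, Quot.sound}.
-/

namespace Summit.Ventures.HodgeRepro2.T7SupportTwoVectorArchimedeanCharacter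

open MeasureTheory
open scoped InnerProductSpace
open T5HaarCircle T5SU11Unimodular T7SupportTwoTorusInvariant T7SupportWeightTorusOrbital
  T7SupportWeightTorusContinuous T7SupportTwoVectorArchimedean T7SupportDenseRegularProduct

variable [MeasurableSpace Circle] [BorelSpace Circle]

variable {G₁ : Type*} [Group G₁] [TopologicalSpace G₁] [ContinuousMul G₁] {V₁ : Type*} [NormedAddCommGroup V₁]
  [InnerProductSpace ℂ V₁]

/-- **on a `τ`-stable line with continuous character the two-vector orbital integral is continuous in `γ`** -/
theorem continuous_twoVectorOrbital_of_character {τ : G₁ →* (V₁ →ₗ[ℂ] V₁)} (hτ : IsUnitaryRep τ)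
    {ρA ρB : Circle →* G₁} {a b : ℤ} {x : V₁} (hA : IsWeightVector τ ρA a x) (hB : IsWeightVector τ ρB b x)
    {χ : G₁ → ℂ} (hχ : ∀ g, τ g x = χ g • x) (hχc : Continuous χ) (h : G₁) :
    Continuous (twoVectorOrbital τ ρA ρB x h a b) := by
  have e : twoVectorOrbital τ ρA ρB x h a b = fun γ => χ (γ * h) * ⟪x, x⟫_ℂ :=
    funext fun γ => twoVectorOrbital_eq_of_character hτ hA hB hχ h γ
  rw [e]
  exact (hχc.comp (continuous_id.mul continuous_const)).mul continuous_const

/-- **the model with a character at the compact place**: every dense `S ⊆ G₁ × SU(1,1) × SU(1,1)` contains a `γ₀` regular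
at `ι₂, ι₃` (`κ_v(γ₀) ≠ 1`) with the product of the three two-vector orbital integrals non-zero — nothing required at `ι₁` -/
theorem exists_mem_dense_regular_twoVectorOrbital_ne_zero₃_character {τ : G₁ →* (V₁ →ₗ[ℂ] V₁)} (hτ : IsUnitaryRep τ)
    {ρA ρB : Circle →* G₁} {a b : ℤ} {x : V₁} (hA : IsWeightVector τ ρA a x) (hB : IsWeightVector τ ρB b x) (hx : x ≠ 0)
    {χ : G₁ → ℂ} (hχ : ∀ g, τ g x = χ g • x) (hχc : Continuous χ) (h₁ : G₁)
    (k₂ n₂ : ℕ) (hk₂ : 2 ≤ k₂) (h₂ : SU11) (k₃ n₃ : ℕ) (hk₃ : 2 ≤ k₃) (h₃ : SU11)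
    {S : Set (G₁ × SU11 × SU11)} (hS : Dense S) :
    ∃ γ₀ ∈ S,
      twoVectorOrbital τ ρA ρB x h₁ a b γ₀.1 * T7SupportDenseRegularPoint.torusOrbital k₂ n₂ h₂ γ₀.2.1 *
        T7SupportDenseRegularPoint.torusOrbital k₃ n₃ h₃ γ₀.2.2 ≠ 0 ∧
      kappa (starRingEnd ℂ) T7SupportKappaCartan.dd (T7SupportKappaCartan.colBasis h₂) (T5BergmanCoefficient.mat γ₀.2.1)
        ≠ 1 ∧
      kappa (starRingEnd ℂ) T7SupportKappaCartan.dd (T7SupportKappaCartan.colBasis h₃) (T5BergmanCoefficient.mat γ₀.2.2)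
        ≠ 1 := by
  obtain ⟨s, hsS, h1, h2, h3, -, hZ2, hZ3⟩ := exists_mem_dense_prod₃_ne_zero_notMem hS
    (continuous_twoVectorOrbital_of_character hτ hA hB hχ hχc h₁)
    (T7SupportDenseRegularPoint.continuous_torusOrbital k₂ n₂ hk₂ h₂)
    (T7SupportDenseRegularPoint.continuous_torusOrbital k₃ n₃ hk₃ h₃)
    ⟨1, twoVectorOrbital_ne_zero_of_character hτ hA hB hx hχ h₁ 1⟩
    (let ⟨γ, _, hγ⟩ := T7SupportDenseRegularPoint.nonempty_regularNonvanishing k₂ n₂ hk₂ h₂; ⟨γ, hγ⟩)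
    (let ⟨γ, _, hγ⟩ := T7SupportDenseRegularPoint.nonempty_regularNonvanishing k₃ n₃ hk₃ h₃; ⟨γ, hγ⟩)
    (Z₁ := ∅) isClosed_empty interior_empty
    (T7SupportDenseRegularPoint.isClosed_kappa_eq_one h₂) (T7SupportDenseRegularPoint.interior_kappa_eq_one_eq_empty h₂)
    (T7SupportDenseRegularPoint.isClosed_kappa_eq_one h₃) (T7SupportDenseRegularPoint.interior_kappa_eq_one_eq_empty h₃)
  exact ⟨s, hsS, mul_ne_zero (mul_ne_zero h1 h2) h3, hZ2, hZ3⟩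

/-- the same in coefficient form: `χ(γ₀,1 h₁) ⟪x, x⟫ · ⟨π_{k₂}(γ₀,2 h₂) z^{n₂}, z^{n₂}⟩ · ⟨π_{k₃}(γ₀,3 h₃) z^{n₃}, z^{n₃}⟩ ≠ 0` -/
theorem exists_mem_dense_regular_coeff_ne_zero₃_character {τ : G₁ →* (V₁ →ₗ[ℂ] V₁)} (hτ : IsUnitaryRep τ)
    {ρA ρB : Circle →* G₁} {a b : ℤ} {x : V₁} (hA : IsWeightVector τ ρA a x) (hB : IsWeightVector τ ρB b x) (hx : x ≠ 0)
    {χ : G₁ → ℂ} (hχ : ∀ g, τ g x = χ g • x) (hχc : Continuous χ) (h₁ : G₁)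
    (k₂ n₂ : ℕ) (hk₂ : 2 ≤ k₂) (h₂ : SU11) (k₃ n₃ : ℕ) (hk₃ : 2 ≤ k₃) (h₃ : SU11)
    {S : Set (G₁ × SU11 × SU11)} (hS : Dense S) :
    ∃ γ₀ ∈ S,
      χ (γ₀.1 * h₁) * ⟪x, x⟫_ℂ * T5BergmanMatrixCoeff.matrixCoeff k₂ (fun w => w ^ n₂) (fun w => w ^ n₂) (γ₀.2.1 * h₂) *
        T5BergmanMatrixCoeff.matrixCoeff k₃ (fun w => w ^ n₃) (fun w => w ^ n₃) (γ₀.2.2 * h₃) ≠ 0 ∧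
      kappa (starRingEnd ℂ) T7SupportKappaCartan.dd (T7SupportKappaCartan.colBasis h₂) (T5BergmanCoefficient.mat γ₀.2.1)
        ≠ 1 ∧
      kappa (starRingEnd ℂ) T7SupportKappaCartan.dd (T7SupportKappaCartan.colBasis h₃) (T5BergmanCoefficient.mat γ₀.2.2)
        ≠ 1 := by
  obtain ⟨γ₀, hγS, hne, hZ2, hZ3⟩ := exists_mem_dense_regular_twoVectorOrbital_ne_zero₃_character hτ hA hB hx hχ hχc h₁
    k₂ n₂ hk₂ h₂ k₃ n₃ hk₃ h₃ hS
  refine ⟨γ₀, hγS, ?_, hZ2, hZ3⟩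
  rwa [twoVectorOrbital_eq_of_character hτ hA hB hχ h₁, T7SupportDenseRegularPoint.torusOrbital_eq k₂ n₂ hk₂ h₂,
    T7SupportDenseRegularPoint.torusOrbital_eq k₃ n₃ hk₃ h₃] at hne

end Summit.Ventures.HodgeRepro2.T7SupportTwoVectorArchimedeanCharacter
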